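import Summits.BirchSwinnertonDyer.BirchSwinnertonDyer.Theorems.KimAtThreeDeepUpperOfDefinedKatoUniform
import Summits.BirchSwinnertonDyer.BirchSwinnertonDyer.Theorems.KimAtThreeDeepLowerUniformOfFineKato
import HarnessLib

/-!
# Route `KimAtThreeKolyvagin` (rung W2): the WHOLE deep leaf — `DeepLowerAtThree` (19075), `DeepLowerAtThreeOffKatoStratum`
# (19679), `DeepUpperAtThree` (19076), `DeepUpperAtThreeOffKatoStratum` (19562) and the cell statement
# `N11.KimAtThreeDeepPUB` — BY NAME from the route's four published leaves and the ONE defined-Kato package (C1ₑₓ)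
# (cell `bsd-addord`, seat w2-c3 gen 7; `--supports stmt-BirchSwinnertonDyer-19076`, helper)

HONEST FRAMING: glue/END-type theorems with DISPLAYED hypotheses (no definition, no named fact, no `sorry`); the
conclusions are route decls BY NAME but CONDITIONAL on the displayed package (C1ₑₓ), so NOTHING is closed and
nothing is booked; BSD is not proved by any of this.

## What, and why
The planner's FOLD (STATUS 2026-08-27T03:45:57Z) made the uniform fine Kato package (C1ᵤ) the ONE residual object of
the W2 deep leaf (w2-c2 g7 `KimAtThreeDeepLowerUniformOfFineKato`: 19075 / 19679 / deepPUB ⟸ leaves ∧ (C1ᵤ); this seat's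
gens 6–7: 19076 / 19562).  This seat's `KimAtThreeDeepUpperOfDefinedKatoUniform` replaced (C1ᵤ) by the SMALLER package
(C1ₑₓ) on the UPPER side (its §2 `portFamilyDeep_of_definedKatoUniform`: `Λfin`, the (Λ)-clauses, RIDER₂, `κ ∈ ℚ`,
`κe ≥ 1` DERIVED on every row with `[0]⁺_f ≠ 0`).  (C1ₑₓ) ⟹ (C1ᵤ) itself is NOT claimed (Kato's constant is shown
rational only on rows with `[0]⁺ ≠ 0`, i.e. analytic rank `0` — enough for every crux of the leaf, whose rows all
carry `ord(δ̃) = 0`).  This file runs the LOWER side on (C1ₑₓ) too: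
* §1 `portPairDeep_of_definedKatoUniform` — w2-c2's deep-guard TWO-DEPTH port `PORTPAIR⟦W, t, e, M, v₃, η, P⟧` for SOME
  `(M, t, e)` at every tower row with `[0]⁺ ≠ 0`, from (C1ₑₓ) (same derivation as the upper §2, ending in w2-c2's
  `exists_shift_portPairDeep_of_zetaBody_of_valueRows_pow`).
* §2 `deepLower_optimalRow_of_pinnedFacts_of_definedKatoUniform` — 19075's conclusion at every tower row with a
  lattice-optimal datum at the conductor and `ord(δ̃) = 0` (w2-c2's `deepLower_row_of_portDeep_tors`).
* §3 BY NAME, ROUTE currency: `deepLowerAtThree_of_leaves_of_definedKatoUniform`,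
  `deepLowerAtThreeOffKatoStratum_of_leaves_of_definedKatoUniform`, ★ `deepLower_and_deepUpper_of_leaves_of_definedKatoUniform :
  … → DeepLowerAtThree ∧ DeepUpperAtThree`, ★★ `kimAtThreeDeepPUB_of_leaves_of_definedKatoUniform : … → N11.KimAtThreeDeepPUB`.
NET: the FIVE deep decls of W2 rest on {`SakamotoKolyvaginThree`, `RankEqAnalyticRankLeOne`, `PoitouTateSelmerDuality`,
`CarayolLevelEqConductor`} (cite-only) and (C1ₑₓ) ALONE — (C1ₑₓ) = {κ real ≠ 0; kim3's `hker`/`hdual` ([BK90] 3.8/3.11,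
Tate duality — lattice form, ℚ₃ only); ONE crude compatibility clause X1-int_b; Kato's `ZetaBody` family} (module
docstring of `KimAtThreeDeepUpperOfDefinedKatoUniform`; memo HOME/w2c3/W2C3-DEFINED-KATO-UNIFORM-g7.md §7 has its text).
References: [Kato2004Asterisque] (8.1.3), 8.12, 8.5, §9.4, 9.7, 6.6 (1), 13.3; [BlochKato1990] §3; [Kim2022StructureSelmer] Thm. 1.9 (6),
Thm. 3.13, §3.2–3.4; [Kim2025RefinedTNC] Thm 1.1; [MazurRubin2004] 4.4.1, 5.2.12, App. A Prop. A.2; [Sakamoto2024] Thm. 4.4 (1)(2);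
[MilneADT2006] I.4.10; [Carayol1986]; [EdixhovenManin1991] Prop. 2. -/

set_option autoImplicit false
-- the Theorems namespace of a single-conjunct summit repeats the summit name by design (D-0017)
set_option linter.dupNamespace false

noncomputable section

open scoped NumberField TensorProduct ContRepresentation Classical
open CategoryTheory Field Function Finset IsDedekindDomain NumberField WeierstrassCurve
open Rat.HeightOneSpectrum
open Literature.NumberTheory.GaloisRepresentations Literature.NumberTheory.GaloisCohomology
open Literature.NumberTheory.GaloisRepresentations.DiscreteGaloisModule
open Literature.NumberTheory.EllipticCurves Literature.NumberTheory.EllipticCurves.ModularForms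
open Literature.NumberTheory.EllipticCurves.Rank1Residual
open Literature.NumberTheory.EllipticCurves.Kato2004
open Literature.NumberTheory.EllipticCurves.Kato2004.EulerSystemValues
open Summit.BirchSwinnertonDyer.Rank1Residual.GaloisImage
open Summit.BirchSwinnertonDyer.Rank1Residual.Additive
open Summit.BirchSwinnertonDyer.Rank1Residual.Additive.LocalLog
open Summit.BirchSwinnertonDyer.BirchSwinnertonDyer.Theses.KimAtThreeKolyvagin
open Summit.BirchSwinnertonDyer.BirchSwinnertonDyer.Theorems.KimAtThreeKolyvaginDefs
open Summit.BirchSwinnertonDyer.BirchSwinnertonDyer.Theorems.KimAtThreeKolyvaginInputs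
open Summit.BirchSwinnertonDyer.BirchSwinnertonDyer.Theorems.KimAtThreeKolyvaginIsogenyCruxes
open Summit.BirchSwinnertonDyer.BirchSwinnertonDyer.Theorems.KimAtThreeShallowEqDeepSplitGlueNoStub
open Summit.BirchSwinnertonDyer.BirchSwinnertonDyer.Theorems.KimAtThreeDeepUpperUniformOfFineKato
open Summit.BirchSwinnertonDyer.BirchSwinnertonDyer.Theorems.KimAtThreeDeepUpperNonAdditiveAllOfFineKato
open Summit.BirchSwinnertonDyer.BirchSwinnertonDyer.Theorems.KimAtThreeDeepUpperLocalLatticeUniform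
open Summit.BirchSwinnertonDyer.BirchSwinnertonDyer.Theorems.KimAtThreeDeepUpperRiderOfCompat
open Summit.BirchSwinnertonDyer.BirchSwinnertonDyer.Theorems.KimAtThreeShallowEqDeepZetaBodyScaling
open Summit.BirchSwinnertonDyer.BirchSwinnertonDyer.Theorems.KimAtThreeDeepUpperOfDefinedKatoUniform
open Summit.BirchSwinnertonDyer.BirchSwinnertonDyer.Theorems.KimAtThreeDeepLowerPortPairOfZetaBodyPow
open Summit.BirchSwinnertonDyer.BirchSwinnertonDyer.Theorems.KimAtThreeDeepLowerPortDeepTorsion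

namespace Summit.BirchSwinnertonDyer.BirchSwinnertonDyer.Theorems.KimAtThreeDeepLeafOfDefinedKatoUniform

/-- Local notation: **the DEEP-GUARD TWO-DEPTH PORT at `(t, e, M)`** for `(W, v₃, η, P)` — w2-c2's spelling, copied
VERBATIM from `KimAtThreeDeepLowerUniformOfFineKato`. -/
local notation3 (prettyPrint := false) "PORTPAIR⟦" W' ", " t' ", " e' ", " M' ", " v' ", " η' ", " P' "⟧" =>
  ∀ (k k' : ℕ) (Dk : KolyvaginDatum (WeierstrassCurve.torsionGaloisModule W' (((3 : ℕ) : ℤ) ^ k * ((3 : ℕ) : ℤ))))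
    (Dk' : KolyvaginDatum (WeierstrassCurve.torsionGaloisModule W' (((3 : ℕ) : ℤ) ^ k' * ((3 : ℕ) : ℤ))))
    (red : (WeierstrassCurve.torsionGaloisModule W' (((3 : ℕ) : ℤ) ^ k' * ((3 : ℕ) : ℤ))).toContRepresentation →ⁱL
      (WeierstrassCurve.torsionGaloisModule W' (((3 : ℕ) : ℤ) ^ k * ((3 : ℕ) : ℤ))).toContRepresentation),
    Dk.IsCanonicalTauDatumThreeAtWith W' (k + M') k η' → Dk'.IsCanonicalTauDatumThreeAtWith W' (k' + M') k' η' →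
    k ≤ k' →
    (∀ x : geomTorsion W' (((3 : ℕ) : ℤ) ^ k' * ((3 : ℕ) : ℤ)),
      ((red x : geomTorsion W' (((3 : ℕ) : ℤ) ^ k * ((3 : ℕ) : ℤ))) : geomPoints W') =
        (((3 : ℕ) : ℤ) ^ (k' - k)) • (x : geomPoints W')) →
    ∃ κ Λ κ' κu Λu κu',
      KatoKuriharaWitnessAtTwoExp W' k t' e' Dk v' P' κ Λ κ' ∧
      KatoKuriharaWitnessAtTwoExp W' k' t' e' Dk' v' P' κu Λu κu' ∧
      ∀ d, Dk'.IsLevel d → Dk.IsLevel d →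
        galoisCohomology.map red 1 (κu d) = κ d ∧ galoisCohomology.map red 1 (κu' d) = κ' d

/-! ### §0 The crude compatibility clause (X1-int_b) from a COMPAT-shaped conclusion (acc5's currency) -/

set_option backward.isDefEq.respectTransparency false in
/-- **(X1-int_b) ⟸ acc5's COMPAT shape with the lattice `M_b = {μ : 3^b·μ ∈ L_int}`.**  Seat w2-acc5 gen 4's
`KimAtThreeFineKatoLevelCompat.compat_of_semiLocalDef` (p495637) derives, for ANY `ℤ₃`-submodule `M` and a value datum
`Λ` DEFINED semi-locally from local dual exponentials `φ_w` with restriction-functoriality (RES) and the lattice closure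
(LAT) `Σ_w ι_w(φ_w(z_w)) ∈ M`, the conclusion `∃ μ ∈ M, φ(h) ⊗ 1 − Λ_{k,r}(y) = 3^{j+1}·μ`.  Read with
`M := M_b` (i.e. (LAT) = the CRUDE bound `3^b·exp*_ω(H¹(F_w, T)) ⊆ 𝒪_w` summed over `w`), that conclusion at `k = 0`
IS this seat's clause (X1-int_b) of (C1ₑₓ) — so (X1-int_b) ⟸ (DEF) + (RES) + (LAT_b), the same three properties the
planner now displays for crux 19560's COMPAT (STATUS 2026-08-27T04:25:38Z), with the crude lattice.  Pure algebra.
[cite: Kim2022StructureSelmer, §3.4.1 and the proof of Thm. 3.13 (arXiv v3 pp. 26–27)] -/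
theorem x1int_of_compatShape {A : Type*} [AddCommGroup A] [Module ℤ_[3] A] (L : Submodule ℤ_[3] A) (b j : ℕ)
    {X : A} (h : ∃ μ : A, (((3 : ℕ) : ℤ_[3]) ^ b) • μ ∈ L ∧ X = (((3 : ℕ) : ℤ_[3]) ^ (j + 1)) • μ) :
    ∃ l ∈ L, (((3 : ℕ) : ℤ_[3]) ^ b) • X = (((3 : ℕ) : ℤ_[3]) ^ (j + 1)) • l := by
  obtain ⟨μ, hμ, hX⟩ := h
  exact ⟨(((3 : ℕ) : ℤ_[3]) ^ b) • μ, hμ, by rw [hX, smul_comm]⟩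

section Uniform

variable
  -- (C1ₑₓ) the DEFINED-KATO package, uniform road: per row `(ι, κK, Λ, φ)` with `hker`, `hdual` (kim3's texts
  -- verbatim), the crude compatibility (X1-int_b) between `Λ_{0,r}` and `φ`, and Kato's `ZetaBody` family
  (hKU : ∀ (W : WeierstrassCurve ℚ) [W.IsElliptic] [W.IsGloballyMinimal]
    [ContinuousSMul ℤ_[3] (W.tateModule 3)] [Module.Free ℤ_[3] (W.tateModule 3)]
    [Module.Finite ℤ_[3] (W.tateModule 3)],
    (∀ m : ℕ, W.HasSurjectiveModNGaloisRep (3 ^ m : ℕ)) →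
    ∀ (v₃ : HeightOneSpectrum (𝓞 ℚ)), ((3 : ℕ) : 𝓞 ℚ) ∈ v₃.asIdeal →
    ∀ {N : ℕ} [NeZero N] (P : ModularParametrizationData W N), N = W.conductorNorm ℤ →
      (∀ z ∈ P.L.lattice, ∃ w ∈ periodLattice P.f, z = P.c * w) →
      ∃ (ι : (n : ℕ) → (CyclotomicField n ℚ →+* ℂ)) (κK : ℝ)
        (Λ : ∀ (k' : ℕ) (r : Finset (HeightOneSpectrum (𝓞 ℚ))),
          H1 (tateRep W 3) (cycSubgroup 3 k' r) →ₗ[ℤ_[3]] ℚ_[3] ⊗[ℚ] CyclotomicField (cycLevel 3 k' r) ℚ)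
        (φ : (tateLocalRep W 3 (Sum.inr v₃)).cohomology 1 →+ ℚ_[3]),
        κK ≠ 0 ∧
        -- hker: [BK90] Prop. 3.8 / Ex. 3.11 in lattice form (kernel of `exp*_ω` = `H¹_f = E(ℚ₃) ⊗ ℤ₃`)
        (∀ y, φ y = 0 ↔ ∀ j : ℕ, tateLocalMap W 3 j (Sum.inr v₃) y ∈
          W.kummerSelmerStructure (((3 : ℕ) : ℤ) ^ j * ((3 : ℕ) : ℤ)) (Sum.inr v₃)) ∧
        -- hdual: Tate local duality + [BK90] 3.8 in lattice form (`exp*_ω(H¹) = (log_ω E(ℚ₃))^∨`)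
        (∀ a : ℚ_[3], (∃ y, φ y = a) ↔
          ∀ Q : (W.baseChange ℚ_[3]).toAffine.Point, ‖a * padicLog (W.baseChange ℚ_[3]) Q‖ ≤ 1) ∧
        -- (X1-int_b): `Λ_{0,r}` agrees with `φ` modulo `3^{j+1-b}·L_int` on restriction-compatible classes
        (∃ b : ℕ, ∀ (j : ℕ) (r : Finset (HeightOneSpectrum (𝓞 ℚ)))
          (Ψ : H1 (tateRep W 3) (cycSubgroup 3 0 r) →+
            continuousCohomology 1 (subgroupRep
              (W.torsionGaloisModule (((3 : ℕ) : ℤ) ^ j * ((3 : ℕ) : ℤ))).toTopRep (cycSubgroup 3 0 r))),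
          (∀ (φ₁ : contOneCocycles (subgroupRep (tateRep W 3).toTopRep (cycSubgroup 3 0 r)))
              (ψ : contOneCocycles (subgroupRep
                (W.torsionGaloisModule (((3 : ℕ) : ℤ) ^ j * ((3 : ℕ) : ℤ))).toTopRep (cycSubgroup 3 0 r))),
              (∀ g, ((ψ.1 g : geomTorsion W (((3 : ℕ) : ℤ) ^ j * ((3 : ℕ) : ℤ))) : geomPoints W) =
                TateModule.proj 3 (j + 1) (φ₁.1 g)) →
              Ψ (oneCocycleClass _ φ₁) = oneCocycleClass _ ψ) →
          ∀ (y : H1 (tateRep W 3) (cycSubgroup 3 0 r))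
            (κ₀ : galoisCohomology (W.torsionGaloisModule (((3 : ℕ) : ℤ) ^ j * ((3 : ℕ) : ℤ))) 1)
            (h : (tateLocalRep W 3 (Sum.inr v₃)).cohomology 1),
            resSubgroup (W.torsionGaloisModule (((3 : ℕ) : ℤ) ^ j * ((3 : ℕ) : ℤ))).toTopRep
                (cycSubgroup 3 0 r) 1 κ₀ = Ψ y →
            galoisCohomology.localization (W.torsionGaloisModule (((3 : ℕ) : ℤ) ^ j * ((3 : ℕ) : ℤ)))
                (Sum.inr v₃) 1 κ₀ = tateLocalMap W 3 j (Sum.inr v₃) h →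
            ∃ l ∈ cycIntLattice 3 (cycLevel 3 0 r),
              (((3 : ℕ) : ℤ_[3]) ^ b) • ((φ h ⊗ₜ[ℚ] (1 : CyclotomicField (cycLevel 3 0 r) ℚ)) - Λ 0 r y) =
                (((3 : ℕ) : ℤ_[3]) ^ (j + 1)) • (l : _)) ∧
        -- Kato's Euler system with its values in the coordinate `Λ`
        ∀ (c d a : ℤ) (A : ℕ), 0 < A → Int.gcd c (6 * 3 * A) = 1 → Int.gcd d (6 * 3 * N) = 1 →
          ∃ (z : ∀ (k' : ℕ) (r : (cyclotomicLevelsRat 3 (badPlaces c d A N)).Ideals),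
                H1 (tateRep W 3) ((cyclotomicLevelsRat 3 (badPlaces c d A N)).level k' r.1))
            (x : ∀ (k' : ℕ) (r : (cyclotomicLevelsRat 3 (badPlaces c d A N)).Ideals),
                CyclotomicField (cycLevel 3 k' r.1) ℚ),
            ZetaBody W 3 P.f ι κK Λ c d a A z x)

include hKU

set_option backward.isDefEq.respectTransparency false in
/-- **w2-c2's deep-guard two-depth port at EVERY tower row with `[0]⁺_f ≠ 0`, from (C1ₑₓ) alone** (certificate
supply = gen 6's THEOREM `certSupply_uniform`): the derivation of `KimAtThreeDeepUpperOfDefinedKatoUniform` §2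
(`κ ∈ ℚ`; normalised `φ′`, `λ₀`, `Λfin` with the (Λ)-clauses; scaling exponent; `3^a`-scaled body; RIDER₂ at
`(0, a + λ₀)`; gen 6's certificate bookkeeping), ending in w2-c2's `exists_shift_portPairDeep_of_zetaBody_of_valueRows_pow`.
Output `∃ M t e, PORTPAIR⟦W, t, e, M, v₃, η, P⟧` (`M` a torsion-stable shift, `t = κe + β − 1`).  Closes nothing.
[cite: Kato2004Asterisque, (8.1.3) (p. 180), §9.4 (p. 188), Thm. 9.7 (p. 189) and Ex. 13.3 (pp. 224–225)]
[cite: Kim2022StructureSelmer, Thm. 3.13, Lemma 3.4 / 3.10 / 3.11 and §2.2.2] [cite: BlochKato1990, §3 (Prop. 3.8, Ex. 3.11)]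
[cite: MazurRubin2004, App. A Prop. A.2 and Thm. 3.2.4] -/
theorem portPairDeep_of_definedKatoUniform :
    ∀ (W : WeierstrassCurve ℚ) [W.IsElliptic] [W.IsGloballyMinimal],
      (∀ m : ℕ, W.HasSurjectiveModNGaloisRep (3 ^ m : ℕ)) →
      ∀ (v₃ : HeightOneSpectrum (𝓞 ℚ)), ((3 : ℕ) : 𝓞 ℚ) ∈ v₃.asIdeal →
      ∀ (η : (q : HeightOneSpectrum (𝓞 ℚ)) → (ZMod (Ideal.absNorm q.asIdeal))ˣ),
        (∀ q, Subgroup.zpowers (η q) = ⊤) →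
      ∀ {N : ℕ} [NeZero N] (P : ModularParametrizationData W N), N = W.conductorNorm ℤ →
        (∀ z ∈ P.L.lattice, ∃ w ∈ periodLattice P.f, z = P.c * w) →
        ratPlusSymbol P.f 0 ≠ 0 →
        ∃ M t e : ℕ, PORTPAIR⟦W, t, e, M, v₃, η, P⟧ := by
  intro W _ _ htow v₃ hv₃ η _hη N _ P hN hlat h0
  haveI : Fact (Nat.Prime 3) := ⟨Nat.prime_three⟩
  haveI : ContinuousSMul ℤ_[3] (W.tateModule 3) := TateModule.continuousSMul_padicInt
  haveI : Module.Free ℤ_[3] (W.tateModule 3) := W.module_free_tateModule_holds 3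
  haveI : Module.Finite ℤ_[3] (W.tateModule 3) := W.module_finite_tateModule_holds 3
  -- gen 6's certificate supply (a THEOREM on every row)
  obtain ⟨c, d, a, A, d', aM, β, hApos, hcA, hdN, hcdA, hcd, hdd', hAN, haM, hE0, hE, hR0, hR⟩ :=
    certSupply_uniform W htow P
  haveI : NeZero A := ⟨hApos.ne'⟩
  -- the defined-Kato package at this row, and Kato's body for the certificate's datum
  obtain ⟨ι, κK, Λ, φ, hκ0, hker, hdual, ⟨b, hcompat⟩, hz⟩ := hKU W htow v₃ hv₃ P hN hlat
  obtain ⟨z, x, hbody⟩ := hz c d a A hApos hcA hdN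
  have hirr : W.HasIrreducibleModPGaloisRep 3 :=
    KimAtThreeKolyvaginPortShared.hasIrreducibleModPGaloisRep_three_of_tower W htow
  obtain ⟨uκ, huκ⟩ := exists_ratCast_eq_kappa_of_zetaBody P hbody h0 d' hcd hdd' aM haM hE0 hR0
  have huκ0 : uκ ≠ 0 := by rintro rfl; exact hκ0 (by rw [← huκ, Rat.cast_zero])
  obtain ⟨φ', lam, Λfin, hint', hφ, hΛ, hI⟩ :=
    exists_finLevelFunctional_clauses_of_dual W 3 (Sum.inr v₃) φ hker hdual
  obtain ⟨aS, hab, hav, hal⟩ : ∃ aS : ℕ, b ≤ aS ∧ 1 ≤ padicValRat 3 uκ + aS ∧ 0 ≤ (aS : ℤ) + lam := by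
    refine ⟨b + (1 - padicValRat 3 uκ).toNat + (-lam).toNat, by omega, ?_, ?_⟩
    · have := Int.self_le_toNat (1 - padicValRat 3 uκ); push_cast; omega
    · have := Int.self_le_toNat (-lam); push_cast; omega
  set e : ℕ := ((aS : ℤ) + lam).toNat with hedef
  have he : (e : ℤ) = ((0 : ℕ) : ℤ) + aS + lam := by rw [hedef, Int.toNat_of_nonneg hal]; push_cast; ring
  set κe : ℕ := (padicValRat 3 uκ + aS).toNat with hκedef
  have hκe1 : 1 ≤ κe := by
    have : ((κe : ℕ) : ℤ) = padicValRat 3 uκ + aS := by rw [hκedef, Int.toNat_of_nonneg (by omega)]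
    omega
  -- the `3^{aS}`-scaled body and its constant
  have hbody' := zetaBody_smul (3 ^ aS) hbody
  have hΛeq : (fun k r => ((3 ^ aS : ℕ) : ℤ_[3]) • Λ k r) =
      (fun k' r => (((3 : ℕ) : ℤ_[3]) ^ aS) • Λ k' r) := by
    funext k' r; rw [Nat.cast_pow]
  rw [hΛeq] at hbody'
  set uκ' : ℚ := (3 : ℚ) ^ aS * uκ with huκ'def
  have huκ' : (uκ' : ℝ) = ((3 ^ aS : ℕ) : ℝ) * κK := by
    rw [huκ'def, ← huκ]; push_cast; ring
  have hκ0' : ((3 ^ aS : ℕ) : ℝ) * κK ≠ 0 := mul_ne_zero (by positivity) hκ0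
  have huκ'0 : uκ' ≠ 0 := mul_ne_zero (by positivity) huκ0
  have hvu : padicValRat 3 uκ' = κe := by
    have hκe : ((κe : ℕ) : ℤ) = padicValRat 3 uκ + aS := by rw [hκedef, Int.toNat_of_nonneg (by omega)]
    have h3 : padicValRat 3 (3 : ℚ) = 1 := by exact_mod_cast padicValRat.self (p := 3) (by norm_num)
    rw [huκ'def, padicValRat.mul (by positivity) huκ0, padicValRat.pow, h3, hκe]
    ring
  -- RIDER₂ at `(0, e)` for the scaled datum, every depth
  have hfin₂ := fun j => rider₂_of_compat W v₃ Λ φ φ' lam hφ hint' j (Λfin j) (hI j) b (hcompat j) aS 0 e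
    hab he
  -- gen 6's certificate bookkeeping for `uκ'` with `v₃(uκ') = κe ≥ 1`
  have hnorm3 : ‖(uκ' : ℚ_[3])‖ = (3 : ℝ) ^ (-(κe : ℤ)) := by
    rw [Padic.norm_eq_zpow_neg_valuation (by exact_mod_cast huκ'0), Padic.valuation_ratCast, hvu]
    norm_num
  have hnorm3le : ‖(uκ' : ℚ_[3])‖ ≤ 3⁻¹ := by
    rw [hnorm3, show (3 : ℝ)⁻¹ = (3 : ℝ) ^ (-(1 : ℤ)) by norm_num]
    exact zpow_le_zpow_right₀ (by norm_num) (by omega)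
  have huκ1 : ‖(uκ' : ℚ_[3])‖ ≤ 1 := hnorm3le.trans (by norm_num)
  have hthird : ∀ m : ℤ, ‖((uκ' * ((m : ℚ) / (3 : ℕ)) : ℚ) : ℚ_[3])‖ ≤ 1 := by
    intro m
    rw [Rat.cast_mul, norm_mul, Rat.cast_div, norm_div, Rat.cast_intCast, Rat.cast_natCast, Nat.cast_ofNat]
    have h3 : ‖(3 : ℚ_[3])‖ = 3⁻¹ := by
      have := Padic.norm_p (p := 3)
      simpa using this
    rw [h3]
    have hm : ‖((m : ℤ) : ℚ_[3])‖ ≤ 1 := Padic.norm_int_le_one m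
    have : ‖((m : ℤ) : ℚ_[3])‖ / 3⁻¹ = 3 * ‖((m : ℤ) : ℚ_[3])‖ := by field_simp
    rw [this]
    nlinarith [norm_nonneg ((m : ℤ) : ℚ_[3]), norm_nonneg (uκ' : ℚ_[3])]
  have hκa : ‖((uκ' * ((aM 3 : ℚ) / (3 : ℕ)) : ℚ) : ℚ_[3])‖ ≤ 1 := hthird (aM 3)
  have hκ1 : ‖((uκ' * (if 3 ∣ N then 0 else (1 / (3 : ℕ) : ℚ)) : ℚ) : ℚ_[3])‖ ≤ 1 := by
    by_cases h3N : 3 ∣ N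
    · rw [if_pos h3N, mul_zero, Rat.cast_zero, norm_zero]; exact zero_le_one
    · rw [if_neg h3N]
      have h := hthird 1
      rw [Int.cast_one] at h
      exact h
  have hκE : padicValRat 3
      (uκ' * ∏ q ∈ (3 * A).primeFactors, (1 - (aM q : ℚ) / q + (if q ∣ N then 0 else (1 / q : ℚ)))) =
        ((κe + β - 1 : ℕ) : ℤ) := by
    rw [padicValRat.mul huκ'0 hE0, hvu, hE, Nat.cast_sub (hκe1.trans (Nat.le_add_right κe β))]
    push_cast
    ring
  obtain ⟨M, hPort⟩ := exists_shift_portPairDeep_of_zetaBody_of_valueRows_pow W P hN hbody' hirr hv₃ Λfin hΛ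
    hfin₂ (η := η) hcdA uκ' huκ' hκ0' huκ1 d' hcd hdd' hAN aM haM hκa hκ1 hE0 hκE hR0 hR
  exact ⟨M, 0 + (κe + β - 1), e, hPort⟩

/-! ### §2 The LOWER row at EVERY tower row from [S24] PINNED + GZK + PT + (C1ₑₓ) -/

/-- **Crux 19075's conclusion at EVERY tower row with a lattice-optimal datum at the conductor and `ord(δ̃) = 0`:
`∃ d, ∂^{(∞)}_deep = d ∧ ∂⁽⁰⁾ ≤ ord₃ #Ш(3) + d`, from [S24] Thm 4.4 (1)(2) PINNED, GZK, Poitou–Tate and (C1ₑₓ) ALONE**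
(`[0]⁺ ≠ 0` from `ord(δ̃) = 0`; the port of §1 feeds w2-c2 g6's reduction-blind LOWER row `deepLower_row_of_portDeep_tors`).
NO reduction-type split, NO S24-DEEP flag, NO Manin / period / `c₃` / local-torsion hypothesis.
[cite: Kim2025RefinedTNC, Thm 1.1] [cite: Kim2022StructureSelmer, Thm. 1.9 (6), Thm. 3.13]
[cite: Sakamoto2024, Thm. 4.4 (1)(2) (p. 926)] [cite: MazurRubin2004, Thm. 5.2.12 and App. A Prop. A.2]
[cite: MilneADT2006, Ch. I, Thm. 4.10] -/
theorem deepLower_optimalRow_of_pinnedFacts_of_definedKatoUniform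
    (hS24 : Sakamoto2024.kolyvaginSystems_freeRankOne_zmod_three_pow)
    (hS24₂ : Sakamoto2024.kolyvaginSystems_idealOfBasis_eq_fittingIdeal_zmod_three_pow)
    (hGZK : rank_eq_analyticRank_of_analyticRank_le_one)
    (hPT : poitouTate_selmerStructure_duality ℚ)
    (W₀ : WeierstrassCurve ℚ) [W₀.IsElliptic] [W₀.IsGloballyMinimal]
    (htow : ∀ n : ℕ, W₀.HasSurjectiveModNGaloisRep (3 ^ n : ℕ))
    {N : ℕ} [NeZero N] (hN : N = W₀.conductorNorm ℤ) (D₀ : ModularParametrizationData W₀ N)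
    (hopt : ∀ z ∈ D₀.L.lattice, ∃ w ∈ periodLattice D₀.f, z = D₀.c * w)
    (hord : kuriharaVanishingOrder W₀ 3 D₀.f = 0) :
    ∃ d : ℕ, kuriharaPartialDeepInfty W₀ 3 D₀.f = d ∧ kuriharaPartial W₀ 3 D₀.f 0 ≤
      ((padicValNat 3 (Nat.card (AddCommGroup.primaryComponent W₀.sha 3)) + d : ℕ) : ℕ∞) := by
  haveI : Fact (Nat.Prime 3) := ⟨Nat.prime_three⟩
  have h0 : ratPlusSymbol D₀.f 0 ≠ 0 :=
    KimAtThreeKolyvaginUnitLevelOneRungs.ratPlusSymbol_zero_ne_zero_of_kuriharaVanishingOrder_eq_zero W₀ 3 D₀.f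
      hord
  obtain ⟨v₃, η, hv₃, hη⟩ := exists_place_three_and_generators
  obtain ⟨M, t, e, hPort⟩ := portPairDeep_of_definedKatoUniform hKU W₀ htow v₃ hv₃ η hη D₀ hN hopt h0
  exact deepLower_row_of_portDeep_tors hS24 hS24₂ hGZK hPT W₀ htow hN D₀ t e M hord v₃ hv₃ η hη hPort

/-! ### §3 The deep leaf BY NAME in the ROUTE's currency -/

/-- **Crux `DeepLowerAtThree` (stmt-BirchSwinnertonDyer-19075) BY NAME from (C1ₑₓ) and the route's four leaves**
(kim3's transport `deepLowerAtThree_of_forall_optimalDatum_atConductor` fed §2).  Conditional; nothing is booked.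
[cite: Kim2025RefinedTNC, Thm 1.1] [cite: Sakamoto2024, Thm. 4.4 (1)(2) (p. 926)] [cite: Carayol1986]
[cite: MazurRubin2004, Thm. 5.2.12 and App. A Prop. A.2] -/
theorem deepLowerAtThree_of_leaves_of_definedKatoUniform (hSak : SakamotoKolyvaginThree)
    (hGZK : RankEqAnalyticRankLeOne) (hPT : PoitouTateSelmerDuality) (hlev : CarayolLevelEqConductor) :
    Summit.BirchSwinnertonDyer.BirchSwinnertonDyer.Theses.KimAtThreeKolyvagin.DeepLowerAtThree :=
  deepLowerAtThree_of_forall_optimalDatum_atConductor hlev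
    fun W₀ _ _ htow _ _ _ hN D₀ hopt _ _ hord =>
      deepLower_optimalRow_of_pinnedFacts_of_definedKatoUniform hKU hSak.1 hSak.2 hGZK hPT W₀ htow hN D₀ hopt hord

/-- **Crux `DeepLowerAtThreeOffKatoStratum` (stmt-BirchSwinnertonDyer-19679) BY NAME from (C1ₑₓ) and three leaves**
(`SakamotoKolyvaginThree`, `RankEqAnalyticRankLeOne`, `PoitouTateSelmerDuality`; the off-stratum antecedent and
degree-minimality are idle: the row theorem holds everywhere).  Conditional.
[cite: Kim2025RefinedTNC, Thm 1.1] [cite: Sakamoto2024, Thm. 4.4 (1)(2) (p. 926)] -/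
theorem deepLowerAtThreeOffKatoStratum_of_leaves_of_definedKatoUniform (hSak : SakamotoKolyvaginThree)
    (hGZK : RankEqAnalyticRankLeOne) (hPT : PoitouTateSelmerDuality) :
    Summit.BirchSwinnertonDyer.BirchSwinnertonDyer.Theses.KimAtThreeKolyvagin.DeepLowerAtThreeOffKatoStratum :=
  fun W₀ _ _ htow _ _ _ hN D₀ hopt _ _ hord _ =>
    deepLower_optimalRow_of_pinnedFacts_of_definedKatoUniform hKU hSak.1 hSak.2 hGZK hPT W₀ htow hN D₀ hopt hord

/-- ★ **Both parent cruxes `DeepLowerAtThree ∧ DeepUpperAtThree` (19075 ∧ 19076) BY NAME from (C1ₑₓ) and the route's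
four leaves** (upper half = `KimAtThreeDeepUpperOfDefinedKatoUniform.deepUpperAtThree_of_leaves_of_definedKatoUniform`).
Conditional; nothing is booked. [cite: Kim2025RefinedTNC, Thm 1.1] [cite: Sakamoto2024, Thm. 4.4 (1)(2) (p. 926)]
[cite: Carayol1986] [cite: Kato2004Asterisque, §9.4 and Thm. 9.7 (pp. 188–189)] -/
theorem deepLower_and_deepUpper_of_leaves_of_definedKatoUniform (hSak : SakamotoKolyvaginThree)
    (hGZK : RankEqAnalyticRankLeOne) (hPT : PoitouTateSelmerDuality) (hlev : CarayolLevelEqConductor) :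
    Summit.BirchSwinnertonDyer.BirchSwinnertonDyer.Theses.KimAtThreeKolyvagin.DeepLowerAtThree ∧
      Summit.BirchSwinnertonDyer.BirchSwinnertonDyer.Theses.KimAtThreeKolyvagin.DeepUpperAtThree :=
  ⟨deepLowerAtThree_of_leaves_of_definedKatoUniform hKU hSak hGZK hPT hlev,
    deepUpperAtThree_of_leaves_of_definedKatoUniform hKU hSak hGZK hPT hlev⟩

/-- ★★ **The cell's DEEP statement `N11.KimAtThreeDeepPUB` BY NAME from (C1ₑₓ) and the route's four leaves** —
Kim's `p = 3` Sha-length formula in the deep-limit currency, `∂^{(∞)}_deep(δ̃) = d ∈ ℕ` and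
`∂⁽⁰⁾(δ̃) = ord₃ #Ш(E)(3) + d`, on EVERY `3`-adic-tower row of analytic rank `0` (kim3's
`kimAtThreeDeepPUB_iff_lower_and_upper` on ★; the four leaves as ONE conjunction `SakamotoKolyvaginThree ∧ RankEqAnalyticRankLeOne ∧
PoitouTateSelmerDuality ∧ CarayolLevelEqConductor`).  The ONE residual object of the whole W2 deep statement on this road is
(C1ₑₓ).  Conditional: does not discharge the obligation node; nothing booked.
[cite: Kim2025RefinedTNC, Thm 1.1] [cite: Kim2022StructureSelmer, Thm. 1.9 (6), Thm. 3.13]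
[cite: MazurRubin2004, App. A Prop. A.2, Thm. 4.4.1 and Thm. 5.2.12] [cite: Sakamoto2024, Thm. 4.4 (p. 926)] [cite: Carayol1986] -/
theorem kimAtThreeDeepPUB_of_leaves_of_definedKatoUniform :
    SakamotoKolyvaginThree ∧ RankEqAnalyticRankLeOne ∧ PoitouTateSelmerDuality ∧ CarayolLevelEqConductor →
      N11.KimAtThreeDeepPUB :=
  fun h => kimAtThreeDeepPUB_iff_lower_and_upper.mpr
    (deepLower_and_deepUpper_of_leaves_of_definedKatoUniform hKU h.1 h.2.1 h.2.2.1 h.2.2.2)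

end Uniform

end Summit.BirchSwinnertonDyer.BirchSwinnertonDyer.Theorems.KimAtThreeDeepLeafOfDefinedKatoUniform

end
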